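import Literature.AlgebraicGeometry.Motives.MumfordTateGroupOfCMFamilyRealPointsProduct
import Literature.AlgebraicGeometry.HodgeTheory.CMBettiHodgeGroupRealPoints
import HarnessLib

/-!
# `MT(A)(ℝ) ≅ ℝ^×_{>0} × Hg(A)(ℝ) ≅ ℝ^×_{>0} × U(1)^{rank - 1}` FOR ONE CM TYPE, ONE CM ABELIAN VARIETY AND PRODUCTS
# `∏ᵢ Aᵢ` OF CM ABELIAN VARIETIES (transport of `Motives/MumfordTateGroupOfCMFamilyRealPointsProduct`)

Family `hodge`, lane `lit-hodgefound` (Track 2 foundations library; Layer A3 «the Mumford–Tate group of a CM abelian variety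
is a torus» / A4 «products»), layer `Literature/AlgebraicGeometry/HodgeTheory`, sub-namespaces
`Literature.AlgebraicGeometry.Motives.HodgeStructure` (§1, one CM type) and `Literature.AlgebraicGeometry.HodgeTheory.CMBettiModel`
(§2–§3, actual abelian varieties), as `HodgeTheory/CMBettiHodgeGroupRealPoints`, of which this is the `MT` companion.
THEOREMS ONLY (no definition, no named fact; D-0026 net debt `0`).  A TRANSPORT file.

THE PRINTS.  M. Green, P. Griffiths, M. Kerr (2012) [GreenGriffithsKerr2012] §I.B (semi-direct product remark before
(I.B.1)) «`M_φ̃` is the almost direct product `𝔾_m · M_φ`», (I.B.7) (functoriality).  B. Moonen (2004) [Moonen2004MT]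
(5.8) «`Hg = Ker(MT → 𝔾_m)`».  J. S. Milne, *Algebraic Groups* [Milne2017] Ch. 12 Example 12.27, Exercise 12-7 (a) «a
torus over `ℝ` is a direct product of copies of `𝔾_m`, `U₁`, `(𝔾_m)_{ℂ/ℝ}`».  B. B. Gordon [Gordon1999HodgeAVSurvey] §2
proof of Prop. 2.10 («the connected center of `Hg(A,ℝ)` is compact»), Remark 2.12, §9.1 «`rank(K,S) := dim MT(A)`».  P.
Deligne [Deligne1982HodgeCycles] I Example 3.7 (pp. 25–26) («`A = ∏ Aᵢ`», the multiplier `e₀`).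

THE OBJECTS.  §1: a CM field `K` with CM type `Φ`, `V¹_{(K,Φ)} = ofCMType Φ` (the one-member family `⊕_{•} V¹ ≅ V¹`),
`rank Φ = cmTypeRank Φ`.  §2: `h : IsCMTypeRealisation Φ A ι θ`, `hHD`, `hI`, `H¹(A) = BettiUniverse.hodge hHD h.1 1`.
§3: `hA : ∀ i, IsCMTypeRealisation (Φ i) (A i) (ι i) (θ i)` (`I ≠ ∅`), `⊕ᵢ H¹(Aᵢ) = HodgeStructure.pi …`, `rank Σ =
CMAlgebra.cmFamilyRank Φ`.  The positive real homotheties as Mathlib's `Units.posSubgroup ℝ`; `U(1)` = Mathlib's `Circle`.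

WHAT IS PROVED.  §1 **`nonempty_mumfordTateGroupBaseChange_real_ofCMType_mulEquiv_posSubgroup_prod_hodgeGroupBaseChange`**
(`MT(V¹_{(K,Φ)})(ℝ) ≅ ℝ^×_{>0} × Hg(V¹_{(K,Φ)})(ℝ)`), **`…_mulEquiv_posSubgroup_prod_pi_circle`** (`≅ ℝ^×_{>0} ×
U(1)^{rank Φ - 1}`); §2 the same two for `H¹(A(ℂ); ℚ)` of ONE CM abelian variety
(**`nonempty_mumfordTateGroupBaseChange_hodge_real_mulEquiv_posSubgroup_prod_hodgeGroupBaseChange`**,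
**`nonempty_mumfordTateGroupBaseChange_hodge_real_mulEquiv_posSubgroup_prod_pi_circle`**); §3 the same two for
`⊕ᵢ H¹(Aᵢ(ℂ); ℚ)` of a PRODUCT (**`nonempty_mumfordTateGroupBaseChange_pi_hodge_real_mulEquiv_posSubgroup_prod_hodgeGroupBaseChange`**,
**`nonempty_mumfordTateGroupBaseChange_pi_hodge_real_mulEquiv_posSubgroup_prod_pi_circle`**).  Mechanism: the model
statement `nonempty_mumfordTateGroupBaseChange_real_ofCMFamily_mulEquiv_posSubgroup_prod_hodgeGroupBaseChange` and the
tree's `MT`/`Hg` isomorphisms under isomorphisms of Hodge structures (`…_pi_const_mulEquiv`, `…_hodge_mulEquiv_ofCMType`,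
`…_pi_hodge_mulEquiv_ofCMFamily`), composed with `MulEquiv.prodCongr`.

DEVIATIONS / SCOPE.  As abstract groups (no topology); Tannaka-free.  NOT HERE: `ℓ`-adic points.

## References
* [GreenGriffithsKerr2012] M. Green, P. A. Griffiths, M. Kerr, *Mumford–Tate Groups and Domains* (2012) — §I.B.
* [Moonen2004MT] B. Moonen, *An introduction to Mumford–Tate groups* (2004) — (5.8).
* [Milne2017] J. S. Milne, *Algebraic Groups*, CUP (2017) — Ch. 12: Example 12.27, Exercise 12-7.
* [Gordon1999HodgeAVSurvey] B. B. Gordon, *A survey of the Hodge conjecture for abelian varieties* (1999) — 2.10 (proof),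
  2.12, §9.1.
* [Deligne1982HodgeCycles] P. Deligne, *Hodge cycles on abelian varieties*, in LNM 900 (1982) — I Example 3.7 (re-edition pp. 25–26).

## Provenance
Lane `lit-hodgefound` (Hodge path, Track 2), prover seat `lit-hodgefound-p29` (generation 21), self-proposed row g21-#12
(the «NOT HERE: the transport to `H¹(∏ᵢ Aᵢ)`» of the seat's g21-#11 `Motives/MumfordTateGroupOfCMFamilyRealPointsProduct`).
-/

noncomputable section

open scoped TensorProduct
open NumberField CategoryTheory Module
open scoped Literature.NumberTheory.ComplexMultiplication

namespace Literature.AlgebraicGeometry.Motives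

namespace HodgeStructure

/-! ### §1 ONE CM type: `MT(V¹_{(K,Φ)})(ℝ) ≅ ℝ^×_{>0} × Hg(V¹_{(K,Φ)})(ℝ) ≅ ℝ^×_{>0} × U(1)^{rank Φ - 1}` -/

section OneType

variable {K : Type} [Field K] [NumberField K] [IsCMField K] (Φ : CMType K) [HodgeTensorFacts.{0, 0}]

/-- **`MT(V¹_{(K,Φ)})(ℝ) ≅ ℝ^×_{>0} × Hg(V¹_{(K,Φ)})(ℝ)` for ONE CM type** (`K` a CM field; the one-member family
`⊕_{•} V¹_{(K,Φ)} ≅ V¹_{(K,Φ)}`; GGK «`M_φ̃ = 𝔾_m · M_φ`», on real points an honest direct product with the positive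
homotheties). [cite: GreenGriffithsKerr2012, §I.B (semi-direct product remark before (I.B.1)) and (I.B.7)] [cite: Moonen2004MT, (5.8)] -/
theorem nonempty_mumfordTateGroupBaseChange_real_ofCMType_mulEquiv_posSubgroup_prod_hodgeGroupBaseChange :
    Nonempty ((ofCMType Φ).mumfordTateGroupBaseChange ℝ ≃* Units.posSubgroup ℝ × (ofCMType Φ).hodgeGroupBaseChange ℝ) := by
  obtain ⟨φ⟩ := nonempty_mumfordTateGroupBaseChange_pi_const_mulEquiv (ι := PUnit) ℝ (ofCMType Φ)
  obtain ⟨χ⟩ := nonempty_hodgeGroupBaseChange_pi_const_mulEquiv (ι := PUnit) ℝ (ofCMType Φ)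
  obtain ⟨ψ⟩ :=
    nonempty_mumfordTateGroupBaseChange_real_ofCMFamily_mulEquiv_posSubgroup_prod_hodgeGroupBaseChange (fun _ : PUnit => Φ)
  exact ⟨φ.symm.trans (ψ.trans (MulEquiv.prodCongr (MulEquiv.refl _) χ))⟩

/-- **`MT(V¹_{(K,Φ)})(ℝ) ≅ ℝ^×_{>0} × U(1)^{rank Φ - 1}` for ONE CM type** (Milne Ex. 12-7 (a); `dim MT = rank Φ`,
Gordon 9.1). [cite: Milne2017, Ch. 12, Example 12.27, Exercise 12-7] [cite: Gordon1999HodgeAVSurvey, §9.1 and §2 Remark 2.12] -/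
theorem nonempty_mumfordTateGroupBaseChange_real_ofCMType_mulEquiv_posSubgroup_prod_pi_circle :
    Nonempty ((ofCMType Φ).mumfordTateGroupBaseChange ℝ ≃*
      Units.posSubgroup ℝ × (Fin (Pohlmann1968.cmTypeRank Φ - 1) → Circle)) := by
  obtain ⟨φ⟩ := nonempty_mumfordTateGroupBaseChange_real_ofCMType_mulEquiv_posSubgroup_prod_hodgeGroupBaseChange Φ
  obtain ⟨ψ⟩ := nonempty_hodgeGroupBaseChange_real_ofCMType_mulEquiv_pi_circle Φ
  exact ⟨φ.trans (MulEquiv.prodCongr (MulEquiv.refl _) ψ)⟩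

end OneType

end HodgeStructure

end Literature.AlgebraicGeometry.Motives

namespace Literature.AlgebraicGeometry.HodgeTheory

namespace CMBettiModel

open Literature.AlgebraicGeometry.Motives (CMType HodgeStructure AbelianVariety bettiCohomology HodgeTensorFacts)
open Literature.AlgebraicGeometry.Motives.HodgeStructure (ofCMType ofCMFamily)
open Literature.AlgebraicGeometry.ComplexMultiplication (IsCMTypeRealisation)
open Literature.AlgebraicGeometry.Pohlmann1968 (cmTypeRank CMAlgebra.cmFamilyRank)

/-! ### §2 ONE CM abelian variety `A` of type `(K; Φ)`: `MT(H¹(A))(ℝ) ≅ ℝ^×_{>0} × Hg(H¹(A))(ℝ) ≅ ℝ^×_{>0} × U(1)^{rank Φ - 1}` -/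

section One

variable {K : Type} [Field K] [NumberField K] [IsCMField K] {Φ : CMType K} {A : AbelianVariety ℂ} {ι : 𝓞 K →+* End A}
  {θ : K →+* Module.End ℂ (complexBetti A.X 1)} [HodgeTensorFacts.{0, 0}]
  [Module.Finite ℚ (bettiCohomology A.X 1)]

/-- **`MT(H¹(A(ℂ); ℚ))(ℝ) ≅ ℝ^×_{>0} × Hg(H¹(A(ℂ); ℚ))(ℝ)` for an ACTUAL CM abelian variety** (Gordon 2.10 proof: «the
connected center of `Hg(A,ℝ)` is compact» — for CM type, `MT(A,ℝ)` is the positive homotheties times the compact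
`Hg(A,ℝ)`). [cite: Gordon1999HodgeAVSurvey, §2 proof of Prop. 2.10 and Remark 2.12] [cite: GreenGriffithsKerr2012, §I.B (before (I.B.1))] -/
theorem nonempty_mumfordTateGroupBaseChange_hodge_real_mulEquiv_posSubgroup_prod_hodgeGroupBaseChange
    (h : IsCMTypeRealisation Φ A ι θ) (hHD : exists_isReal_hodgeModel) (hI : hodgePQ_independent_of_hodgeModel) :
    Nonempty ((BettiUniverse.hodge hHD h.1 1).mumfordTateGroupBaseChange ℝ ≃*
      Units.posSubgroup ℝ × (BettiUniverse.hodge hHD h.1 1).hodgeGroupBaseChange ℝ) := by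
  obtain ⟨φ⟩ := nonempty_mumfordTateGroupBaseChange_hodge_mulEquiv_ofCMType h hHD hI ℝ
  obtain ⟨χ⟩ := nonempty_hodgeGroupBaseChange_hodge_mulEquiv_ofCMType h hHD hI ℝ
  obtain ⟨ψ⟩ :=
    HodgeStructure.nonempty_mumfordTateGroupBaseChange_real_ofCMType_mulEquiv_posSubgroup_prod_hodgeGroupBaseChange Φ
  exact ⟨φ.trans (ψ.trans (MulEquiv.prodCongr (MulEquiv.refl _) χ.symm))⟩

/-- **`MT(H¹(A(ℂ); ℚ))(ℝ) ≅ ℝ^×_{>0} × U(1)^{rank Φ - 1}` for an actual CM abelian variety** (`dim MT(A) = rank(K,S)`).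
[cite: Gordon1999HodgeAVSurvey, §9.1 and §2 proof of Prop. 2.10] [cite: Milne2017, Ch. 12, Example 12.27, Exercise 12-7] -/
theorem nonempty_mumfordTateGroupBaseChange_hodge_real_mulEquiv_posSubgroup_prod_pi_circle
    (h : IsCMTypeRealisation Φ A ι θ) (hHD : exists_isReal_hodgeModel) (hI : hodgePQ_independent_of_hodgeModel) :
    Nonempty ((BettiUniverse.hodge hHD h.1 1).mumfordTateGroupBaseChange ℝ ≃*
      Units.posSubgroup ℝ × (Fin (cmTypeRank Φ - 1) → Circle)) := by
  obtain ⟨φ⟩ := nonempty_mumfordTateGroupBaseChange_hodge_mulEquiv_ofCMType h hHD hI ℝ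
  obtain ⟨ψ⟩ := HodgeStructure.nonempty_mumfordTateGroupBaseChange_real_ofCMType_mulEquiv_posSubgroup_prod_pi_circle Φ
  exact ⟨φ.trans ψ⟩

end One

/-! ### §3 PRODUCTS `∏ᵢ Aᵢ`: `MT(⊕ᵢ H¹(Aᵢ))(ℝ) ≅ ℝ^×_{>0} × Hg(⊕ᵢ H¹(Aᵢ))(ℝ) ≅ ℝ^×_{>0} × U(1)^{rank Σ - 1}` -/

section Product

variable {I : Type} [Fintype I] [DecidableEq I] {K : I → Type} [∀ i, Field (K i)] [∀ i, NumberField (K i)]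
  [∀ i, IsCMField (K i)] {Φ : ∀ i, CMType (K i)} {A : I → AbelianVariety ℂ} {ι : ∀ i, 𝓞 (K i) →+* End (A i)}
  {θ : ∀ i, K i →+* Module.End ℂ (complexBetti (A i).X 1)} [HodgeTensorFacts.{0, 0}]
  [∀ i, Module.Finite ℚ (bettiCohomology (A i).X 1)]

/-- **`MT(⊕ᵢ H¹(Aᵢ(ℂ); ℚ))(ℝ) ≅ ℝ^×_{>0} × Hg(⊕ᵢ H¹(Aᵢ(ℂ); ℚ))(ℝ)` for a product of CM abelian varieties** (`I ≠ ∅`;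
Deligne I Example 3.7 «`A = ∏ Aᵢ`»). [cite: Deligne1982HodgeCycles, I Example 3.7 (a)–(d) (pp. 25–26)]
[cite: GreenGriffithsKerr2012, §I.B (before (I.B.1)) and (I.B.7)] [cite: Moonen2004MT, (5.8)] -/
theorem nonempty_mumfordTateGroupBaseChange_pi_hodge_real_mulEquiv_posSubgroup_prod_hodgeGroupBaseChange
    [Nontrivial (∀ i, K i)] (hA : ∀ i, IsCMTypeRealisation (Φ i) (A i) (ι i) (θ i))
    (hHD : exists_isReal_hodgeModel) (hI : hodgePQ_independent_of_hodgeModel) :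
    Nonempty ((HodgeStructure.pi fun i => BettiUniverse.hodge hHD (hA i).1 1).mumfordTateGroupBaseChange ℝ ≃*
      Units.posSubgroup ℝ × (HodgeStructure.pi fun i => BettiUniverse.hodge hHD (hA i).1 1).hodgeGroupBaseChange ℝ) := by
  obtain ⟨φ⟩ := nonempty_mumfordTateGroupBaseChange_pi_hodge_mulEquiv_ofCMFamily hA hHD hI ℝ
  obtain ⟨χ⟩ := nonempty_hodgeGroupBaseChange_pi_hodge_mulEquiv_ofCMFamily hA hHD hI ℝ
  obtain ⟨ψ⟩ :=
    HodgeStructure.nonempty_mumfordTateGroupBaseChange_real_ofCMFamily_mulEquiv_posSubgroup_prod_hodgeGroupBaseChange Φ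
  exact ⟨φ.trans (ψ.trans (MulEquiv.prodCongr (MulEquiv.refl _) χ.symm))⟩

/-- **`MT(⊕ᵢ H¹(Aᵢ(ℂ); ℚ))(ℝ) ≅ ℝ^×_{>0} × U(1)^{rank Σ - 1}` for a product of CM abelian varieties** (`dim MT = rank Σ`,
Gordon 9.1; Milne Ex. 12-7 (a)). [cite: Milne2017, Ch. 12, Example 12.27, Exercise 12-7] [cite: Gordon1999HodgeAVSurvey, §9.1]
[cite: Deligne1982HodgeCycles, I Example 3.7 (d) (p. 26)] -/
theorem nonempty_mumfordTateGroupBaseChange_pi_hodge_real_mulEquiv_posSubgroup_prod_pi_circle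
    [Nontrivial (∀ i, K i)] (hA : ∀ i, IsCMTypeRealisation (Φ i) (A i) (ι i) (θ i))
    (hHD : exists_isReal_hodgeModel) (hI : hodgePQ_independent_of_hodgeModel) :
    Nonempty ((HodgeStructure.pi fun i => BettiUniverse.hodge hHD (hA i).1 1).mumfordTateGroupBaseChange ℝ ≃*
      Units.posSubgroup ℝ × (Fin (CMAlgebra.cmFamilyRank Φ - 1) → Circle)) := by
  obtain ⟨φ⟩ := nonempty_mumfordTateGroupBaseChange_pi_hodge_mulEquiv_ofCMFamily hA hHD hI ℝ
  obtain ⟨ψ⟩ := HodgeStructure.nonempty_mumfordTateGroupBaseChange_real_ofCMFamily_mulEquiv_posSubgroup_prod_pi_circle Φ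
  exact ⟨φ.trans ψ⟩

end Product

end CMBettiModel

end Literature.AlgebraicGeometry.HodgeTheory

end
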